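import Summits.CriticalPhenomena.Ising3DConformalLimit.Theorems.AnomalousForcesInteractionEtaPositiveGainIOEntrances
import Mathlib.Analysis.SpecialFunctions.Log.Base
import HarnessLib

/-!
# Crux `EtaPositive` (stmt-CriticalPhenomena-2600) from gains at a LACUNARY sequence of scales

Support file for crux `EtaPositive := ∃ κ > 0, C, ∀ x ≠ 0, G(x) ≤ C ‖x‖^{-(1+κ)}` of route
`AnomalousForcesInteraction` (sub-problem `Ising3DConformalLimit`), `G(x) = ⟨σ₀σ_x⟩⁺_{β_c(3),0}`
(`criticalTwoPoint 3`, sup norm on `ℤ³`), `G_m := G(m e₁)` the (antitone, Messager–Miracle-Solé) axis sequence.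

The i.o. child `EtaGainIO` (`∀ N ∃ x, N < ‖x‖ ∧ G(x) ≤ C‖x‖^{-(1+κ)}`, files `…GainIOEntrances`, `…SplitGlue`)
lets the prover choose the scales but is strictly weaker than the crux; the crux asks for the gain at ALL sites.
This file locates the gap exactly at SCALE DENSITY: a gain certified only along a sequence of scales
`L₀, L₁, …` that is unbounded and LACUNARY (`L_{k+1} ≤ M L_k`, bounded ratio) — the format produced by any
dyadic / block-spin / renormalisation-group bookkeeping — already gives the full crux, with the same exponent
and constant multiplied by `M^{1+κ}` (MMS fill-in between consecutive scales).

* `axis_gain_of_lacunary` — quantitative fill-in: `G_{L_k} ≤ C L_k^{-(1+κ)}` (all `k`) gives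
  `G_m ≤ (L₀^{1+κ} + C M^{1+κ}) m^{-(1+κ)}` for all `m ≥ 1`.
* `EtaPositive_of_lacunary_axis_gain`, `EtaPositive_iff_dyadic_axis_gain` — the crux from / iff a gain at
  lacunary (resp. the dyadic `2^k`) axis scales.
* `EtaPositive_of_doubling_contraction` — the strategist's strengthening S⁺(b) (STRATEGY-CENSUS §Strengthen)
  as a lemma: an eventual doubling contraction `G_{2n} ≤ θ G_n`, `θ < 1/2`, `n ≥ n₀`, gives the crux with
  `1 + κ = log₂(1/θ)` (only the dyadic multiples `2^k n₀` are used).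
* `EtaPositive_of_lacunary_boxSum_gain`, `EtaPositive_of_lacunary_bubble_gain` — the same with the
  finite-size-scaling currencies `Σ_{Λ_L} G ≤ C L^{2-κ}` / `B_L = Σ_{Λ_L} G² ≤ C L^{1-κ}` certified only at
  lacunary scales `L_k ≥ 1` (MMS averaging puts the gain at the axis scales `3 L_k`, again lacunary).

(The companion file `…EtaPositiveDirichletAbscissa` gives the one-number currency `EtaPositive ⟺ ∃ s > 0,
Σ_m m^s G_m < ∞`.)

All statements are unconditional bookkeeping about the nearest-neighbour Ising model on `ℤ³` (standard
axioms, no named fact); tree inputs: `criticalTwoPoint_axis_antitone`, `EtaPositive_iff_axis_gain`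
(p165244), `card_box_mul_criticalTwoPoint_le_boxSum`, `card_box_mul_criticalTwoPoint_sq_le_bubble`,
`rpow_neg_le_nine_mul_rpow_three_mul` (p172298).
-/

noncomputable section

namespace Summit.CriticalPhenomena.Ising3DConformalLimit.AnomalousForcesInteractionEtaPositive

open Finset Literature.Probability.LatticeModels

/-! ### Lacunary fill-in along the antitone axis sequence -/

/-- **Lacunary fill-in (quantitative).** Let `L : ℕ → ℕ` be unbounded with bounded ratios
`L (k+1) ≤ M · L k` (`M ≥ 1`), and suppose the axis gain `G(L_k e₁) ≤ C L_k^{-(1+κ)}` at every scale `L_k`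
(`C ≥ 0`, `κ > 0`). Then `G(m e₁) ≤ (L₀^{1+κ} + C M^{1+κ}) m^{-(1+κ)}` for every `m ≥ 1`: for `m < L₀` use
`G ≤ 1`; otherwise bracket `L_j ≤ m < L_{j+1} ≤ M L_j` and use that `m ↦ G(m e₁)` is antitone
(Messager–Miracle-Solé). -/
theorem axis_gain_of_lacunary {κ C M : ℝ} (hκ : 0 < κ) (hC : 0 ≤ C) (hM : 1 ≤ M) {L : ℕ → ℕ}
    (hunb : ∀ N : ℕ, ∃ k, N ≤ L k) (hratio : ∀ k, (L (k + 1) : ℝ) ≤ M * L k)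
    (hgain : ∀ k, criticalTwoPoint 3 (Pi.single 0 (L k : ℤ)) ≤ C * (L k : ℝ) ^ (-(1 + κ))) :
    ∀ m : ℕ, 1 ≤ m → criticalTwoPoint 3 (Pi.single 0 (m : ℤ)) ≤
      (((L 0 : ℕ) : ℝ) ^ (1 + κ) + C * M ^ (1 + κ)) * (m : ℝ) ^ (-(1 + κ)) := by
  intro m hm
  have hm0 : (0 : ℝ) < m := by exact_mod_cast hm
  have hM0 : 0 < M := one_pos.trans_le hM
  have hG1 : criticalTwoPoint 3 (Pi.single 0 (m : ℤ)) ≤ 1 :=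
    twoPointPlus_le_one_of_nonneg (criticalBeta_nonneg 3) _
  have ht0 : 0 < (m : ℝ) ^ (-(1 + κ)) := Real.rpow_pos_of_pos hm0 _
  have hA0 : 0 ≤ ((L 0 : ℕ) : ℝ) ^ (1 + κ) := Real.rpow_nonneg (Nat.cast_nonneg _) _
  have hB0 : 0 ≤ C * M ^ (1 + κ) := mul_nonneg hC (Real.rpow_nonneg hM0.le _)
  by_cases hsmall : m < L 0
  · -- SMALL CASE `m < L₀`: `G ≤ 1 ≤ L₀^{1+κ} m^{-(1+κ)}`
    have hmL : (m : ℝ) ≤ L 0 := by exact_mod_cast hsmall.le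
    have h1 : 1 ≤ ((L 0 : ℕ) : ℝ) ^ (1 + κ) * (m : ℝ) ^ (-(1 + κ)) := by
      rw [Real.rpow_neg hm0.le, ← div_eq_mul_inv, le_div_iff₀ (Real.rpow_pos_of_pos hm0 _), one_mul]
      exact Real.rpow_le_rpow hm0.le hmL (by linarith)
    calc criticalTwoPoint 3 (Pi.single 0 (m : ℤ)) ≤ 1 := hG1
      _ ≤ ((L 0 : ℕ) : ℝ) ^ (1 + κ) * (m : ℝ) ^ (-(1 + κ)) := h1
      _ ≤ (((L 0 : ℕ) : ℝ) ^ (1 + κ) + C * M ^ (1 + κ)) * (m : ℝ) ^ (-(1 + κ)) := by nlinarith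
  · -- MAIN CASE `L₀ ≤ m`: bracket `L_j ≤ m < L_{j+1} ≤ M L_j`
    replace hsmall : L 0 ≤ m := not_lt.1 hsmall
    have hex : ∃ k, m < L k := by
      obtain ⟨k, hk⟩ := hunb (m + 1)
      exact ⟨k, by omega⟩
    classical
    obtain ⟨k₀, hk₀, hmin⟩ : ∃ k₀, m < L k₀ ∧ ∀ j, j < k₀ → ¬ m < L j :=
      ⟨Nat.find hex, Nat.find_spec hex, fun j hj => Nat.find_min hex hj⟩
    have hk₀0 : k₀ ≠ 0 := by
      rintro rfl
      exact (not_lt.2 hsmall) hk₀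
    obtain ⟨j, rfl⟩ := Nat.exists_eq_succ_of_ne_zero hk₀0
    have hjm : L j ≤ m := not_lt.1 (hmin j (Nat.lt_succ_self j))
    have hmj : (m : ℝ) < L (j + 1) := by exact_mod_cast hk₀
    have hLj : (m : ℝ) / M ≤ L j := by
      rw [div_le_iff₀ hM0]
      have := hratio j
      nlinarith
    have hmM : 0 < (m : ℝ) / M := div_pos hm0 hM0
    -- antitone: `G(m e₁) ≤ G(L_j e₁) ≤ C L_j^{-(1+κ)} ≤ C (m/M)^{-(1+κ)} = C M^{1+κ} m^{-(1+κ)}`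
    have hanti : criticalTwoPoint 3 (Pi.single 0 (m : ℤ)) ≤ criticalTwoPoint 3 (Pi.single 0 (L j : ℤ)) :=
      criticalTwoPoint_axis_antitone hjm
    have hpow : ((L j : ℕ) : ℝ) ^ (-(1 + κ)) ≤ ((m : ℝ) / M) ^ (-(1 + κ)) :=
      Real.rpow_le_rpow_of_nonpos hmM hLj (by linarith)
    have hdiv : ((m : ℝ) / M) ^ (-(1 + κ)) = M ^ (1 + κ) * (m : ℝ) ^ (-(1 + κ)) := by
      rw [Real.div_rpow hm0.le hM0.le, Real.rpow_neg hM0.le, div_inv_eq_mul, mul_comm]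
    calc criticalTwoPoint 3 (Pi.single 0 (m : ℤ))
        ≤ criticalTwoPoint 3 (Pi.single 0 (L j : ℤ)) := hanti
      _ ≤ C * ((L j : ℕ) : ℝ) ^ (-(1 + κ)) := hgain j
      _ ≤ C * (((m : ℝ) / M) ^ (-(1 + κ))) := mul_le_mul_of_nonneg_left hpow hC
      _ = C * M ^ (1 + κ) * (m : ℝ) ^ (-(1 + κ)) := by rw [hdiv, mul_assoc]
      _ ≤ (((L 0 : ℕ) : ℝ) ^ (1 + κ) + C * M ^ (1 + κ)) * (m : ℝ) ^ (-(1 + κ)) := by nlinarith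

/-- **The crux from an axis gain at a lacunary sequence of scales.** If for some `κ > 0`, `C`, `M` and some
unbounded `L : ℕ → ℕ` with `L (k+1) ≤ M · L k` one has `G(L_k e₁) ≤ C L_k^{-(1+κ)}` for all `k`, then
`Summit.CriticalPhenomena.Ising3DConformalLimit.Theses.AnomalousForcesInteraction.EtaPositive` holds (same `κ`).
Compare `etaGainIO_iff_axis_gain_io`: WITHOUT the ratio bound the same data is only the i.o. child `EtaGainIO`. -/
theorem EtaPositive_of_lacunary_axis_gain : (∃ κ C M : ℝ, 0 < κ ∧ ∃ L : ℕ → ℕ, (∀ N : ℕ, ∃ k, N ≤ L k) ∧ (∀ k, (L (k + 1) : ℝ) ≤ M * L k) ∧ ∀ k, Literature.Probability.LatticeModels.criticalTwoPoint 3 (Pi.single 0 (L k : ℤ)) ≤ C * (L k : ℝ) ^ (-(1 + κ))) → Summit.CriticalPhenomena.Ising3DConformalLimit.Theses.AnomalousForcesInteraction.EtaPositive := by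
  rintro ⟨κ, C, M, hκ, L, hunb, hratio, hgain⟩
  rw [EtaPositive_iff_axis_gain]
  -- normalise `C ≥ 0`, `M ≥ 1`
  set C' : ℝ := max C 0 with hC'def
  have hC'0 : 0 ≤ C' := le_max_right _ _
  set M' : ℝ := max M 1 with hM'def
  have hM'1 : 1 ≤ M' := le_max_right _ _
  have hratio' : ∀ k, (L (k + 1) : ℝ) ≤ M' * L k := fun k =>
    (hratio k).trans (mul_le_mul_of_nonneg_right (le_max_left _ _) (Nat.cast_nonneg _))
  have hgain' : ∀ k, criticalTwoPoint 3 (Pi.single 0 (L k : ℤ)) ≤ C' * (L k : ℝ) ^ (-(1 + κ)) := fun k =>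
    (hgain k).trans (mul_le_mul_of_nonneg_right (le_max_left _ _) (Real.rpow_nonneg (Nat.cast_nonneg _) _))
  exact ⟨κ, _, hκ, axis_gain_of_lacunary hκ hC'0 hM'1 hunb hratio' hgain'⟩

/-- **`η(3) > 0` in power form ⟺ a power gain at the DYADIC axis scales.** The crux `EtaPositive` is
equivalent to: for some `κ > 0` and `C`, `G(2^k e₁) ≤ C (2^k)^{-(1+κ)}` for every `k` — only the scales `2^k`
need to be certified (lacunary fill-in with `M = 2`; the converse is the restriction of the axis form). -/
theorem EtaPositive_iff_dyadic_axis_gain : Summit.CriticalPhenomena.Ising3DConformalLimit.Theses.AnomalousForcesInteraction.EtaPositive ↔ ∃ κ C : ℝ, 0 < κ ∧ ∀ k : ℕ, Literature.Probability.LatticeModels.criticalTwoPoint 3 (Pi.single 0 ((2 ^ k : ℕ) : ℤ)) ≤ C * ((2 ^ k : ℕ) : ℝ) ^ (-(1 + κ)) := by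
  constructor
  · rw [EtaPositive_iff_axis_gain]
    rintro ⟨κ, C, hκ, h⟩
    exact ⟨κ, C, hκ, fun k => h (2 ^ k) (Nat.one_le_two_pow)⟩
  · rintro ⟨κ, C, hκ, h⟩
    refine EtaPositive_of_lacunary_axis_gain ⟨κ, C, 2, hκ, fun k => 2 ^ k, ?_, ?_, h⟩
    · exact fun N => ⟨N, (Nat.lt_two_pow_self).le⟩
    · intro k
      push_cast
      rw [pow_succ]
      linarith

/-! ### The doubling contraction (strategist's S⁺(b)) -/

/-- **An eventual doubling contraction of the axis two-point function gives the crux.** If for some `θ < 1/2`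
and `n₀ ≥ 1` one has `G(2n e₁) ≤ θ G(n e₁)` for all `n ≥ n₀` (a contraction strictly beating the canonical
halving `2^{-1}` of the infrared bound at every scale), then `EtaPositive` holds, with `1 + κ = log₂ (1/θ')`,
`θ' = max θ (1/4)`: iterating along `2^k n₀` gives `G(2^k n₀ e₁) ≤ θ'^k = (2^k)^{-(1+κ)}`, a dyadic-lacunary
gain. (Strengthening S⁺(b) of `Cruxes/EtaPositive/STRATEGY-CENSUS.md`; no uniform `θ` is expected at non-regular
scales, but the lemma records exactly what a per-scale contraction would buy.) -/
theorem EtaPositive_of_doubling_contraction : (∃ θ : ℝ, ∃ n₀ : ℕ, θ < 1 / 2 ∧ 1 ≤ n₀ ∧ ∀ n : ℕ, n₀ ≤ n → Literature.Probability.LatticeModels.criticalTwoPoint 3 (Pi.single 0 ((2 * n : ℕ) : ℤ)) ≤ θ * Literature.Probability.LatticeModels.criticalTwoPoint 3 (Pi.single 0 (n : ℤ))) → Summit.CriticalPhenomena.Ising3DConformalLimit.Theses.AnomalousForcesInteraction.EtaPositive := by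
  rintro ⟨θ, n₀, hθ, hn₀, h⟩
  -- normalised contraction factor `θ' ∈ [1/4, 1/2)`
  set θ' : ℝ := max θ (1 / 4) with hθ'def
  have hθ'0 : 0 < θ' := lt_of_lt_of_le (by norm_num) (le_max_right _ _)
  have hθ'half : θ' < 1 / 2 := max_lt hθ (by norm_num)
  have hG0 : ∀ y : Site 3, 0 ≤ criticalTwoPoint 3 y := fun y =>
    twoPointPlus_nonneg_of_gks (criticalBeta_nonneg 3) y
  -- iterate: `G(2^k n₀ e₁) ≤ θ'^k`
  have hiter : ∀ k : ℕ, criticalTwoPoint 3 (Pi.single 0 ((2 ^ k * n₀ : ℕ) : ℤ)) ≤ θ' ^ k := by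
    intro k
    induction k with
    | zero =>
      simp only [pow_zero]
      exact twoPointPlus_le_one_of_nonneg (criticalBeta_nonneg 3) _
    | succ k ih =>
      have hnk : n₀ ≤ 2 ^ k * n₀ := Nat.le_mul_of_pos_left n₀ (Nat.two_pow_pos k)
      have hstep := h (2 ^ k * n₀) hnk
      have he : (2 * (2 ^ k * n₀) : ℕ) = 2 ^ (k + 1) * n₀ := by rw [pow_succ]; ring
      rw [he] at hstep
      calc criticalTwoPoint 3 (Pi.single 0 ((2 ^ (k + 1) * n₀ : ℕ) : ℤ))
          ≤ θ * criticalTwoPoint 3 (Pi.single 0 ((2 ^ k * n₀ : ℕ) : ℤ)) := hstep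
        _ ≤ θ' * criticalTwoPoint 3 (Pi.single 0 ((2 ^ k * n₀ : ℕ) : ℤ)) :=
            mul_le_mul_of_nonneg_right (le_max_left _ _) (hG0 _)
        _ ≤ θ' * θ' ^ k := mul_le_mul_of_nonneg_left ih hθ'0.le
        _ = θ' ^ (k + 1) := by rw [pow_succ, mul_comm]
  -- the exponent `1 + κ = -log₂ θ' > 1`
  set κ : ℝ := -Real.logb 2 θ' - 1 with hκdef
  have hlogb : Real.logb 2 θ' < -1 := by
    have h1 : Real.logb 2 θ' < Real.logb 2 (1 / 2) := Real.logb_lt_logb one_lt_two hθ'0 hθ'half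
    have h2 : Real.logb 2 (1 / 2) = -1 := by
      rw [one_div, Real.logb_inv, Real.logb_self_eq_one one_lt_two]
    linarith
  have hκ0 : 0 < κ := by rw [hκdef]; linarith
  have hexp : -(1 + κ) = Real.logb 2 θ' := by rw [hκdef]; ring
  -- `θ'^k = (2^k)^{-(1+κ)}`
  have hθpow : ∀ k : ℕ, θ' ^ k = ((2 ^ k : ℕ) : ℝ) ^ (-(1 + κ)) := by
    intro k
    rw [hexp, Nat.cast_pow, Nat.cast_ofNat, ← Real.rpow_natCast (2 : ℝ) k,
      ← Real.rpow_mul (by norm_num : (0 : ℝ) ≤ 2), mul_comm, Real.rpow_mul (by norm_num : (0 : ℝ) ≤ 2),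
      Real.rpow_logb two_pos (by norm_num) hθ'0, Real.rpow_natCast]
  -- lacunary data: scales `2^k n₀`, ratio `2`, constant `n₀^{1+κ}`
  have hn₀0 : (0 : ℝ) < n₀ := by exact_mod_cast hn₀
  refine EtaPositive_of_lacunary_axis_gain ⟨κ, (n₀ : ℝ) ^ (1 + κ), 2, hκ0, fun k => 2 ^ k * n₀, ?_, ?_, ?_⟩
  · intro N
    exact ⟨N, (Nat.lt_two_pow_self).le.trans (Nat.le_mul_of_pos_right _ hn₀)⟩
  · intro k
    push_cast
    rw [pow_succ]
    nlinarith [pow_pos (two_pos : (0 : ℝ) < 2) k]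
  · intro k
    have hsplit : ((2 ^ k * n₀ : ℕ) : ℝ) ^ (-(1 + κ)) = ((2 ^ k : ℕ) : ℝ) ^ (-(1 + κ)) * (n₀ : ℝ) ^ (-(1 + κ)) := by
      push_cast
      exact Real.mul_rpow (by positivity) hn₀0.le
    have hcancel : (n₀ : ℝ) ^ (1 + κ) * (n₀ : ℝ) ^ (-(1 + κ)) = 1 := by
      rw [Real.rpow_neg hn₀0.le, mul_inv_cancel₀ (Real.rpow_pos_of_pos hn₀0 _).ne']
    calc criticalTwoPoint 3 (Pi.single 0 ((2 ^ k * n₀ : ℕ) : ℤ)) ≤ θ' ^ k := hiter k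
      _ = ((2 ^ k : ℕ) : ℝ) ^ (-(1 + κ)) := hθpow k
      _ = (n₀ : ℝ) ^ (1 + κ) * ((2 ^ k * n₀ : ℕ) : ℝ) ^ (-(1 + κ)) := by
          rw [hsplit, mul_left_comm, hcancel, mul_one]

/-! ### The finite-size-scaling currencies at lacunary scales -/

/-- **One scale, box sum → axis.** `Σ_{y ∈ Λ_L} G(y) ≤ C L^{2-κ}` at a single scale `L ≥ 1` (`C ≥ 0`, `κ ≤ 1`)
puts the gain at the axis site `3L e₁`: `G(3L e₁) ≤ 9C (3L)^{-(1+κ)}` (Messager–Miracle-Solé averaging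
`(2L+1)³ G(3L e₁) ≤ Σ_{Λ_L} G`, `(2L+1)³ ≥ L³`, `3^{1+κ} ≤ 9`). -/
theorem axis_gain_at_three_mul_of_boxSum_le {L : ℕ} {κ C : ℝ} (hL : 1 ≤ L) (hC : 0 ≤ C) (hκ1 : κ ≤ 1)
    (h : ∑ y ∈ box 3 L, criticalTwoPoint 3 y ≤ C * (L : ℝ) ^ (2 - κ)) :
    criticalTwoPoint 3 (Pi.single 0 ((3 * L : ℕ) : ℤ)) ≤ 9 * C * ((3 * L : ℕ) : ℝ) ^ (-(1 + κ)) := by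
  have hL0 : (0 : ℝ) < L := by exact_mod_cast hL
  set x : Site 3 := Pi.single 0 ((3 * L : ℕ) : ℤ) with hxdef
  have hxnorm : ‖x‖ = ((3 * L : ℕ) : ℝ) := norm_single_axis_nat (3 * L)
  have hxn : Site.supNorm x = 3 * L := by
    have h1 := hxnorm; rw [Site.norm_eq_supNorm] at h1; exact_mod_cast h1
  have hMMS := card_box_mul_criticalTwoPoint_le_boxSum (L := L) (x := x) (by rw [hxn])
  set P : ℝ := (2 * (L : ℝ) + 1) ^ 3 with hPdef
  have hP0 : 0 < P := by positivity
  have hPL : (L : ℝ) ^ 3 ≤ P := pow_le_pow_left₀ hL0.le (by linarith) 3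
  have hPG : P * criticalTwoPoint 3 x ≤ C * (L : ℝ) ^ (2 - κ) := hMMS.trans h
  have hG : criticalTwoPoint 3 x ≤ C * (L : ℝ) ^ (2 - κ) / (L : ℝ) ^ 3 := by
    have h1 : criticalTwoPoint 3 x ≤ C * (L : ℝ) ^ (2 - κ) / P := by
      rw [le_div_iff₀ hP0]; linarith
    exact h1.trans (div_le_div_of_nonneg_left (by positivity) (by positivity) hPL)
  have hpow : (L : ℝ) ^ (2 - κ) / (L : ℝ) ^ 3 = (L : ℝ) ^ (-(1 + κ)) := by
    have hL3 : (L : ℝ) ^ 3 = (L : ℝ) ^ (3 : ℝ) := by rw [← Real.rpow_natCast]; norm_num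
    rw [hL3, ← Real.rpow_sub hL0]
    congr 1; ring
  have h9 : (L : ℝ) ^ (-(1 + κ)) ≤ 9 * ((3 * L : ℕ) : ℝ) ^ (-(1 + κ)) := by
    push_cast
    exact rpow_neg_le_nine_mul_rpow_three_mul hL0 hκ1
  calc criticalTwoPoint 3 x ≤ C * (L : ℝ) ^ (2 - κ) / (L : ℝ) ^ 3 := hG
    _ = C * (L : ℝ) ^ (-(1 + κ)) := by rw [mul_div_assoc, hpow]
    _ ≤ C * (9 * ((3 * L : ℕ) : ℝ) ^ (-(1 + κ))) := mul_le_mul_of_nonneg_left h9 hC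
    _ = 9 * C * ((3 * L : ℕ) : ℝ) ^ (-(1 + κ)) := by ring

/-- **One scale, bubble → axis.** `B_L = Σ_{y ∈ Λ_L} G(y)² ≤ C L^{1-κ}` at a single scale `L ≥ 1` (`C ≥ 0`,
`κ ≤ 2`) gives `G(3L e₁) ≤ 9 √C (3L)^{-(1+κ/2)}` (`(2L+1)³ G(3L e₁)² ≤ B_L`, pointwise MMS squared). -/
theorem axis_gain_at_three_mul_of_bubble_le {L : ℕ} {κ C : ℝ} (hL : 1 ≤ L) (hC : 0 ≤ C) (hκ2 : κ ≤ 2)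
    (h : ∑ y ∈ box 3 L, criticalTwoPoint 3 y ^ 2 ≤ C * (L : ℝ) ^ (1 - κ)) :
    criticalTwoPoint 3 (Pi.single 0 ((3 * L : ℕ) : ℤ)) ≤
      9 * Real.sqrt C * ((3 * L : ℕ) : ℝ) ^ (-(1 + κ / 2)) := by
  have hL0 : (0 : ℝ) < L := by exact_mod_cast hL
  set x : Site 3 := Pi.single 0 ((3 * L : ℕ) : ℤ) with hxdef
  have hxnorm : ‖x‖ = ((3 * L : ℕ) : ℝ) := norm_single_axis_nat (3 * L)
  have hxn : Site.supNorm x = 3 * L := by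
    have h1 := hxnorm; rw [Site.norm_eq_supNorm] at h1; exact_mod_cast h1
  have hG0 : 0 ≤ criticalTwoPoint 3 x := twoPointPlus_nonneg_of_gks (criticalBeta_nonneg 3) x
  have hMMS := card_box_mul_criticalTwoPoint_sq_le_bubble (L := L) (x := x) (by rw [hxn])
  set P : ℝ := (2 * (L : ℝ) + 1) ^ 3 with hPdef
  have hP0 : 0 < P := by positivity
  have hPL : (L : ℝ) ^ 3 ≤ P := pow_le_pow_left₀ hL0.le (by linarith) 3
  have hPG : P * criticalTwoPoint 3 x ^ 2 ≤ C * (L : ℝ) ^ (1 - κ) := hMMS.trans h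
  have hG2 : criticalTwoPoint 3 x ^ 2 ≤ C * (L : ℝ) ^ (1 - κ) / (L : ℝ) ^ 3 := by
    have h1 : criticalTwoPoint 3 x ^ 2 ≤ C * (L : ℝ) ^ (1 - κ) / P := by
      rw [le_div_iff₀ hP0]; linarith
    exact h1.trans (div_le_div_of_nonneg_left (by positivity) (by positivity) hPL)
  have hpow : (L : ℝ) ^ (1 - κ) / (L : ℝ) ^ 3 = ((L : ℝ) ^ (-(1 + κ / 2))) ^ 2 := by
    have hL3 : (L : ℝ) ^ 3 = (L : ℝ) ^ (3 : ℝ) := by rw [← Real.rpow_natCast]; norm_num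
    rw [hL3, ← Real.rpow_sub hL0, ← Real.rpow_natCast, ← Real.rpow_mul hL0.le]
    congr 1; push_cast; ring
  have hsq : criticalTwoPoint 3 x ^ 2 ≤ (Real.sqrt C * (L : ℝ) ^ (-(1 + κ / 2))) ^ 2 := by
    rw [mul_pow, Real.sq_sqrt hC, ← hpow, ← mul_div_assoc]
    exact hG2
  have ht0 : 0 ≤ Real.sqrt C * (L : ℝ) ^ (-(1 + κ / 2)) :=
    mul_nonneg (Real.sqrt_nonneg _) (Real.rpow_nonneg hL0.le _)
  have hG : criticalTwoPoint 3 x ≤ Real.sqrt C * (L : ℝ) ^ (-(1 + κ / 2)) :=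
    (pow_le_pow_iff_left₀ hG0 ht0 two_ne_zero).1 hsq
  have h9 : (L : ℝ) ^ (-(1 + κ / 2)) ≤ 9 * ((3 * L : ℕ) : ℝ) ^ (-(1 + κ / 2)) := by
    push_cast
    exact rpow_neg_le_nine_mul_rpow_three_mul hL0 (by linarith)
  calc criticalTwoPoint 3 x ≤ Real.sqrt C * (L : ℝ) ^ (-(1 + κ / 2)) := hG
    _ ≤ Real.sqrt C * (9 * ((3 * L : ℕ) : ℝ) ^ (-(1 + κ / 2))) :=
      mul_le_mul_of_nonneg_left h9 (Real.sqrt_nonneg _)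
    _ = 9 * Real.sqrt C * ((3 * L : ℕ) : ℝ) ^ (-(1 + κ / 2)) := by ring

/-- **The crux from a susceptibility gain at lacunary scales.** If `Σ_{y ∈ Λ_{L_k}} G(y) ≤ C L_k^{2-κ}` for some
`κ > 0` along an unbounded sequence of scales `L_k ≥ 1` with bounded ratios `L_{k+1} ≤ M L_k` (e.g. `L_k = 2^k`:
the finite-size-scaling statement "`χ_{2^k}(β_c) ≲ 2^{k(2-η)}`, `η > 0`" at the dyadic scales only), then
`EtaPositive` holds (exponent `min κ 1`). The all-scales version is `EtaPositive_iff_boxSum_gain`; the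
one-arbitrary-sequence version only gives the child `EtaGainIO` (`etaGainIO_of_boxSum_gain_io`). -/
theorem EtaPositive_of_lacunary_boxSum_gain : (∃ κ C M : ℝ, 0 < κ ∧ ∃ L : ℕ → ℕ, (∀ N : ℕ, ∃ k, N ≤ L k) ∧ (∀ k, (L (k + 1) : ℝ) ≤ M * L k) ∧ (∀ k, 1 ≤ L k) ∧ ∀ k, ∑ y ∈ Literature.Probability.LatticeModels.box 3 (L k), Literature.Probability.LatticeModels.criticalTwoPoint 3 y ≤ C * (L k : ℝ) ^ (2 - κ)) → Summit.CriticalPhenomena.Ising3DConformalLimit.Theses.AnomalousForcesInteraction.EtaPositive := by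
  rintro ⟨κ, C, M, hκ, L, hunb, hratio, hL1, h⟩
  set κ' : ℝ := min κ 1 with hκ'def
  have hκ'0 : 0 < κ' := lt_min hκ one_pos
  have hκ'1 : κ' ≤ 1 := min_le_right _ _
  have hκ'κ : κ' ≤ κ := min_le_left _ _
  set C' : ℝ := max C 0 with hC'def
  have hC'0 : 0 ≤ C' := le_max_right _ _
  have h' : ∀ k, ∑ y ∈ box 3 (L k), criticalTwoPoint 3 y ≤ C' * (L k : ℝ) ^ (2 - κ') := by
    intro k
    have hL1' : (1 : ℝ) ≤ L k := by exact_mod_cast hL1 k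
    have hp0 : 0 ≤ (L k : ℝ) ^ (2 - κ) := Real.rpow_nonneg (by linarith) _
    calc ∑ y ∈ box 3 (L k), criticalTwoPoint 3 y ≤ C * (L k : ℝ) ^ (2 - κ) := h k
      _ ≤ C' * (L k : ℝ) ^ (2 - κ) := mul_le_mul_of_nonneg_right (le_max_left _ _) hp0
      _ ≤ C' * (L k : ℝ) ^ (2 - κ') :=
        mul_le_mul_of_nonneg_left (Real.rpow_le_rpow_of_exponent_le hL1' (by linarith)) hC'0
  refine EtaPositive_of_lacunary_axis_gain ⟨κ', 9 * C', M, hκ'0, fun k => 3 * L k, ?_, ?_, ?_⟩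
  · intro N
    obtain ⟨k, hk⟩ := hunb N
    exact ⟨k, hk.trans (Nat.le_mul_of_pos_left _ (by norm_num))⟩
  · intro k
    have := hratio k
    push_cast
    nlinarith
  · intro k
    exact axis_gain_at_three_mul_of_boxSum_le (hL1 k) hC'0 hκ'1 (h' k)

/-- **The crux from a bubble gain at lacunary scales.** If `B_{L_k} = Σ_{y ∈ Λ_{L_k}} G(y)² ≤ C L_k^{1-κ}` for some
`κ > 0` along an unbounded sequence of scales `L_k ≥ 1` with bounded ratios `L_{k+1} ≤ M L_k`, then `EtaPositive`
holds (exponent `min κ 1 / 2`). All-scales version: `EtaPositive_iff_bubble_gain`; one arbitrary sequence: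
`etaGainIO_of_bubble_gain_io` (child only). -/
theorem EtaPositive_of_lacunary_bubble_gain : (∃ κ C M : ℝ, 0 < κ ∧ ∃ L : ℕ → ℕ, (∀ N : ℕ, ∃ k, N ≤ L k) ∧ (∀ k, (L (k + 1) : ℝ) ≤ M * L k) ∧ (∀ k, 1 ≤ L k) ∧ ∀ k, ∑ y ∈ Literature.Probability.LatticeModels.box 3 (L k), Literature.Probability.LatticeModels.criticalTwoPoint 3 y ^ 2 ≤ C * (L k : ℝ) ^ (1 - κ)) → Summit.CriticalPhenomena.Ising3DConformalLimit.Theses.AnomalousForcesInteraction.EtaPositive := by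
  rintro ⟨κ, C, M, hκ, L, hunb, hratio, hL1, h⟩
  set κ' : ℝ := min κ 1 with hκ'def
  have hκ'0 : 0 < κ' := lt_min hκ one_pos
  have hκ'1 : κ' ≤ 1 := min_le_right _ _
  have hκ'κ : κ' ≤ κ := min_le_left _ _
  set C' : ℝ := max C 0 with hC'def
  have hC'0 : 0 ≤ C' := le_max_right _ _
  have h' : ∀ k, ∑ y ∈ box 3 (L k), criticalTwoPoint 3 y ^ 2 ≤ C' * (L k : ℝ) ^ (1 - κ') := by
    intro k
    have hL1' : (1 : ℝ) ≤ L k := by exact_mod_cast hL1 k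
    have hp0 : 0 ≤ (L k : ℝ) ^ (1 - κ) := Real.rpow_nonneg (by linarith) _
    calc ∑ y ∈ box 3 (L k), criticalTwoPoint 3 y ^ 2 ≤ C * (L k : ℝ) ^ (1 - κ) := h k
      _ ≤ C' * (L k : ℝ) ^ (1 - κ) := mul_le_mul_of_nonneg_right (le_max_left _ _) hp0
      _ ≤ C' * (L k : ℝ) ^ (1 - κ') :=
        mul_le_mul_of_nonneg_left (Real.rpow_le_rpow_of_exponent_le hL1' (by linarith)) hC'0
  refine EtaPositive_of_lacunary_axis_gain
    ⟨κ' / 2, 9 * Real.sqrt C', M, by positivity, fun k => 3 * L k, ?_, ?_, ?_⟩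
  · intro N
    obtain ⟨k, hk⟩ := hunb N
    exact ⟨k, hk.trans (Nat.le_mul_of_pos_left _ (by norm_num))⟩
  · intro k
    have := hratio k
    push_cast
    nlinarith
  · intro k
    exact axis_gain_at_three_mul_of_bubble_le (hL1 k) hC'0 (by linarith) (h' k)

end Summit.CriticalPhenomena.Ising3DConformalLimit.AnomalousForcesInteractionEtaPositive
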